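import Summits.Parity.GeneralizedHardyLittlewood.Theorems.PrimeLevelFamEdgeMomentsBeyondDiagonalDiagBoseMixedRemainder
import Summits.Parity.GeneralizedHardyLittlewood.Theorems.PrimeLevelFamEdgeMomentsBeyondDiagonalDiagBoseMixedShell
import HarnessLib

/-!
# Route `PrimeLevelFamEdge`, crux K_A `MomentsBeyondDiagonal` (stmt-Parity-20007), line «petersson_layers» v4, stub `stub_diag`:
# **census R2 — STRUCTURE of the Bose coefficients: `c_ab(y) = P_ab(log(1/y)) + r_ab(y)`, `r_ab` small and of bounded variation**

With the shell identity (`…DiagBoseMixedShell`, p819467) and the one-variable profile estimate (`…DiagBoseMixedProfile`: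
`η·I_ab(η) = m_ab(η) + ρ_ab(η)`, `m_ab(η) = ∫₀¹S_ab(L_η, log v)v/(1+v²)²dv`, `|ρ_ab(η)| ≤ C₁η(1+L_η)^{a+b+1}`, `L_η = log(1/η)`):

(model expansion and remainder bounds: `…DiagBoseMixedRemainder`, `shell_model_expand`, `abs_integral_shell_rem_le`,
`abs_integral_shell_rem_small_le`)

* `integrableOn_shell_rem` — `η ↦ ρ_ab(η)/η` is integrable on `(0,1]`;
* `bose_coeff_structure` — **`c_ab(y) = c_ab(1) + A_ab + Σ_{i,j} C(a,i)C(b,j)((−1)^j+(−1)^i)μ_{i+j}(−1/2)^{a+b−i−j}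
  L^{a+b−i−j+1}/(a+b−i−j+1) − R_ab(y)`**, `A_ab = ∫₀¹ρ_ab/η`, `R_ab(y) = ∫₀^y ρ_ab/η`, `|R_ab(y)| ≤ C y(1+L)^{a+b+1}` —
  the polynomial-plus-small-BV-remainder form of every Bose coefficient that the corner/Abel step of the `stub_diag` assembly
  consumes (as K_B's `CornerWeightE` did for `c₀₀ = 𝒲 = L/2 + E`).

Def-free; theorems only. Helper `--supports stmt-Parity-20007`; closes nothing; K_A, K_B and the Parity summit are NOT
proved; nothing about Landau–Siegel zeros.

## References
* E. Kowalski, P. Michel, J. VanderKam, J. reine angew. Math. 526 (2000), (22)–(28) pp. 12–15.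
  [cite: KowalskiMichelVanderKam2000, (22)–(28) — derivation (residues of the diagonal weight, real-variable form)]
-/

noncomputable section

open Real Set MeasureTheory Filter Function Finset

namespace Summit.Parity.GeneralizedHardyLittlewood.Theorems.MomentsBeyondDiagonal.DiagLines

/-- Measurability of the shell profile `η ↦ I_ab(η)` (a parametric integral of a jointly measurable function). -/
theorem measurable_shell_profile (a b : ℕ) :
    Measurable fun η : ℝ ↦ ∫ u in Ioi (0 : ℝ), Real.log u ^ a * Real.log (η / u) ^ b *
        (Real.exp (-(u + η / u)) / (1 - Real.exp (-(u + η / u))) ^ 2) / u := by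
  set F : ℝ × ℝ → ℝ := fun p ↦ if 0 < p.1 then Real.log p.1 ^ a * Real.log (p.2 / p.1) ^ b *
      (Real.exp (-(p.1 + p.2 / p.1)) / (1 - Real.exp (-(p.1 + p.2 / p.1))) ^ 2) / p.1 else 0 with hF
  have hφ : Measurable fun p : ℝ × ℝ ↦ p.1 + p.2 / p.1 := measurable_fst.add (measurable_snd.div measurable_fst)
  have hFm : Measurable F := by
    refine Measurable.ite (measurableSet_lt measurable_const measurable_fst) ?_ measurable_const
    exact ((((Real.measurable_log.comp measurable_fst).pow_const a).mul
      ((Real.measurable_log.comp (measurable_snd.div measurable_fst)).pow_const b)).mul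
      ((Real.measurable_exp.comp hφ.neg).div ((measurable_const.sub (Real.measurable_exp.comp hφ.neg)).pow_const 2))).div
      measurable_fst
  have hsm := hFm.stronglyMeasurable.integral_prod_left' (μ := volume.restrict (Ioi (0 : ℝ)))
  have heq : (fun η : ℝ ↦ ∫ u in Ioi (0 : ℝ), Real.log u ^ a * Real.log (η / u) ^ b *
        (Real.exp (-(u + η / u)) / (1 - Real.exp (-(u + η / u))) ^ 2) / u) = fun η ↦ ∫ u in Ioi (0 : ℝ), F (u, η) := by
    funext η
    refine setIntegral_congr_fun measurableSet_Ioi fun u hu ↦ ?_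
    simp only [hF]
    rw [if_pos (show (0 : ℝ) < u from hu)]
  rw [heq]
  exact hsm.measurable

/-- Measurability of the model `η ↦ m_ab(η)` (an explicit polynomial in `log(1/η)`). -/
theorem measurable_shell_model (a b : ℕ) :
    Measurable fun η : ℝ ↦ ∫ v in Ioc (0 : ℝ) 1, ((-(Real.log (1 / η) / 2) + Real.log v) ^ a *
        (-(Real.log (1 / η) / 2) - Real.log v) ^ b +
          (-(Real.log (1 / η) / 2) - Real.log v) ^ a * (-(Real.log (1 / η) / 2) + Real.log v) ^ b) *
        (v / (1 + v ^ 2) ^ 2) := by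
  have heq : (fun η : ℝ ↦ ∫ v in Ioc (0 : ℝ) 1, ((-(Real.log (1 / η) / 2) + Real.log v) ^ a *
        (-(Real.log (1 / η) / 2) - Real.log v) ^ b +
          (-(Real.log (1 / η) / 2) - Real.log v) ^ a * (-(Real.log (1 / η) / 2) + Real.log v) ^ b) *
        (v / (1 + v ^ 2) ^ 2)) = fun η ↦ ∑ i ∈ Finset.range (a + 1), ∑ j ∈ Finset.range (b + 1),
        (a.choose i : ℝ) * (b.choose j : ℝ) * ((-1) ^ j + (-1) ^ i) * (-(Real.log (1 / η) / 2)) ^ (a - i) *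
          (-(Real.log (1 / η) / 2)) ^ (b - j) * ∫ v in Ioc (0 : ℝ) 1, Real.log v ^ (i + j) * (v / (1 + v ^ 2) ^ 2) := by
    funext η; exact shell_model_expand _ a b
  rw [heq]
  have hL : Measurable fun η : ℝ ↦ -(Real.log (1 / η) / 2) :=
    ((Real.measurable_log.comp (measurable_const.div measurable_id)).div measurable_const).neg
  refine Finset.measurable_sum _ fun i _ ↦ Finset.measurable_sum _ fun j _ ↦ ?_
  exact (((measurable_const.mul (hL.pow_const _)).mul (hL.pow_const _))).mul measurable_const

/-- **The remainder density `ρ_ab(η)/η` is integrable on `(0, 1]`.** [folklore] -/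
theorem integrableOn_shell_rem (a b : ℕ) :
    IntegrableOn (fun η : ℝ ↦ (η * (∫ u in Ioi (0 : ℝ), Real.log u ^ a * Real.log (η / u) ^ b *
        (Real.exp (-(u + η / u)) / (1 - Real.exp (-(u + η / u))) ^ 2) / u) -
      ∫ v in Ioc (0 : ℝ) 1, ((-(Real.log (1 / η) / 2) + Real.log v) ^ a * (-(Real.log (1 / η) / 2) - Real.log v) ^ b +
          (-(Real.log (1 / η) / 2) - Real.log v) ^ a * (-(Real.log (1 / η) / 2) + Real.log v) ^ b) *
        (v / (1 + v ^ 2) ^ 2)) / η) (Ioc 0 1) := by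
  obtain ⟨C₁, hC₁⟩ := shell_profile_model a b
  set N : ℕ := a + b + 1 with hN
  have hN1 : 1 ≤ N := by omega
  set K : ℝ := (2 * (N : ℝ)) ^ N with hK
  obtain ⟨hsq_int, -⟩ := integral_sqrt_div_le one_pos
  set g : ℝ → ℝ := fun η ↦ C₁ * 2 ^ N + C₁ * 2 ^ N * K * (1 / η) ^ (1 / 2 : ℝ) with hg
  have hg_int : IntegrableOn g (Ioc 0 1) := by
    refine IntegrableOn.add ?_ (hsq_int.const_mul _)
    exact (integrableOn_const_iff (C := C₁ * 2 ^ N)).2 (Or.inr (measure_Ioc_lt_top))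
  have hmeas := ((measurable_id.mul (measurable_shell_profile a b)).sub (measurable_shell_model a b)).div measurable_id
  refine Integrable.mono' hg_int hmeas.aestronglyMeasurable ?_
  rw [ae_restrict_iff' measurableSet_Ioc]
  refine ae_of_all _ fun η hη ↦ ?_
  have hη0 : 0 < η := hη.1
  have h := hC₁ η hη0 hη.2
  have hlog := one_add_log_pow_le_of_le hη0 hη.2 le_rfl hN1
  rw [Real.norm_eq_abs, abs_div, abs_of_pos hη0, div_le_iff₀ hη0]
  simp only [one_div, Real.log_one, inv_one, add_zero, one_pow] at hlog ⊢
  calc _ ≤ C₁ * η * (1 + Real.log η⁻¹) ^ N := by simpa only [one_div] using h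
    _ ≤ C₁ * η * (2 ^ N * (1 + (2 * (N : ℝ)) ^ N * η⁻¹ ^ (2⁻¹ : ℝ))) := by
        have hC₁0 : 0 ≤ C₁ := by
          have h1 := hC₁ 1 one_pos le_rfl
          have : (0 : ℝ) ≤ C₁ * 1 * (1 + Real.log (1 / 1)) ^ (a + b + 1) := (abs_nonneg _).trans h1
          simpa using this
        gcongr
    _ = g η * η := by simp only [hg, hK, one_div]; ring

/-! ## §3. The structure theorem -/

-- one long real-variable assembly
set_option maxHeartbeats 800000 in
/-- **STRUCTURE OF THE BOSE COEFFICIENTS (census R2, full form).** For all `a, b` there is `C` such that for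
`0 < y ≤ 1`, `L = log(1/y)`, with `μ_k = ∫₀¹(log v)^k v/(1+v²)² dv`, the shell profile `I_ab` and model `m_ab` as above
and the constant `A_ab = ∫₀¹ (ηI_ab(η) − m_ab(η)) dη/η`:
`|c_ab(y) − (c_ab(1) + A_ab + Σ_{i≤a,j≤b} C(a,i)C(b,j)((−1)^j+(−1)^i) μ_{i+j} (−1/2)^{a−i+b−j} L^{a−i+b−j+1}/(a−i+b−j+1))|
   ≤ C·y·(1+L)^{a+b+1}`
(the difference is exactly `−∫₀^y (ηI_ab − m_ab)dη/η`, whose variation is controlled by `abs_integral_shell_rem_le`).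
[cite: KowalskiMichelVanderKam2000, (22)–(28) — derivation (residues of the diagonal weight: polynomial in log plus small remainder)] -/
theorem bose_coeff_structure (a b : ℕ) : ∃ C : ℝ, ∀ y : ℝ, 0 < y → y ≤ 1 →
    |(∫ u₁ in Ioi (0 : ℝ), Real.log u₁ ^ a *
        ∫ u₂ in Ioi (y / u₁), Real.exp (-(u₁ + u₂)) / (1 - Real.exp (-(u₁ + u₂))) ^ 2 * Real.log u₂ ^ b) -
      ((∫ u₁ in Ioi (0 : ℝ), Real.log u₁ ^ a *
          ∫ u₂ in Ioi (1 / u₁), Real.exp (-(u₁ + u₂)) / (1 - Real.exp (-(u₁ + u₂))) ^ 2 * Real.log u₂ ^ b) +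
        (∫ η in Ioc (0 : ℝ) 1, (η * (∫ u in Ioi (0 : ℝ), Real.log u ^ a * Real.log (η / u) ^ b *
            (Real.exp (-(u + η / u)) / (1 - Real.exp (-(u + η / u))) ^ 2) / u) -
          ∫ v in Ioc (0 : ℝ) 1, ((-(Real.log (1 / η) / 2) + Real.log v) ^ a * (-(Real.log (1 / η) / 2) - Real.log v) ^ b +
              (-(Real.log (1 / η) / 2) - Real.log v) ^ a * (-(Real.log (1 / η) / 2) + Real.log v) ^ b) *
            (v / (1 + v ^ 2) ^ 2)) / η) +
        ∑ i ∈ Finset.range (a + 1), ∑ j ∈ Finset.range (b + 1),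
          (a.choose i : ℝ) * (b.choose j : ℝ) * ((-1) ^ j + (-1) ^ i) *
            (∫ v in Ioc (0 : ℝ) 1, Real.log v ^ (i + j) * (v / (1 + v ^ 2) ^ 2)) *
            ((-1 / 2 : ℝ) ^ (a - i + (b - j)) * Real.log (1 / y) ^ (a - i + (b - j) + 1) / (((a - i + (b - j) : ℕ) : ℝ) + 1)))|
      ≤ C * y * (1 + Real.log (1 / y)) ^ (a + b + 1) := by
  obtain ⟨C, hC⟩ := abs_integral_shell_rem_small_le a b
  refine ⟨C, fun y hy0 hy1 ↦ ?_⟩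
  -- notation
  set I : ℝ → ℝ := fun η ↦ ∫ u in Ioi (0 : ℝ), Real.log u ^ a * Real.log (η / u) ^ b *
      (Real.exp (-(u + η / u)) / (1 - Real.exp (-(u + η / u))) ^ 2) / u with hI
  set m : ℝ → ℝ := fun η ↦ ∫ v in Ioc (0 : ℝ) 1, ((-(Real.log (1 / η) / 2) + Real.log v) ^ a *
      (-(Real.log (1 / η) / 2) - Real.log v) ^ b +
        (-(Real.log (1 / η) / 2) - Real.log v) ^ a * (-(Real.log (1 / η) / 2) + Real.log v) ^ b) *
      (v / (1 + v ^ 2) ^ 2) with hm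
  set μ : ℕ → ℝ := fun k ↦ ∫ v in Ioc (0 : ℝ) 1, Real.log v ^ k * (v / (1 + v ^ 2) ^ 2) with hμ
  -- the shell identity between `y` and `1`
  have hshell := bose_coeff_sub_eq_integral_shell hy0 hy1 a b
  -- integrability of `I` on `(y, 1]` (Fubini) and of the remainder density
  have hI_int : IntegrableOn I (Ioc y 1) := by
    have hG := (integrable_shellGuard (y₂ := (1 : ℝ)) hy0 a b).integral_prod_right
    have hG0 : IntegrableOn (fun η : ℝ ↦ ∫ u in Ioi (0 : ℝ), (uncurry fun u η : ℝ ↦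
        if 0 < u ∧ 0 < η ∧ y < η ∧ η ≤ 1 then Real.log u ^ a * Real.log (η / u) ^ b *
          (Real.exp (-(u + η / u)) / (1 - Real.exp (-(u + η / u))) ^ 2) / u else 0) (u, η)) (Set.Ioi (0 : ℝ)) := hG
    have hsub : Set.Ioc y 1 ⊆ Set.Ioi (0 : ℝ) := fun η hη ↦ hy0.trans hη.1
    have hG' := hG0.mono_set hsub
    refine hG'.congr_fun (fun η hη ↦ ?_) measurableSet_Ioc
    have hη0 : 0 < η := hy0.trans hη.1
    simp only [hI, uncurry]
    refine setIntegral_congr_fun measurableSet_Ioi fun u hu ↦ ?_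
    rw [if_pos ⟨hu, hη0, hη.1, hη.2⟩]
  have hrem := integrableOn_shell_rem a b
  have hrem_y1 : IntegrableOn (fun η ↦ (η * I η - m η) / η) (Ioc y 1) := hrem.mono_set (Ioc_subset_Ioc_left hy0.le)
  have hrem_0y : IntegrableOn (fun η ↦ (η * I η - m η) / η) (Ioc 0 y) := hrem.mono_set (Ioc_subset_Ioc_right hy1)
  have hm_int : IntegrableOn (fun η ↦ m η / η) (Ioc y 1) := by
    refine (hI_int.sub hrem_y1).congr_fun (fun η hη ↦ ?_) measurableSet_Ioc
    have hη0 : (0 : ℝ) < η := hy0.trans hη.1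
    show I η - (η * I η - m η) / η = m η / η
    field_simp
    ring
  -- split `∫ I = ∫ m/η + ∫ ρ/η`
  have hsplit : ∫ η in Ioc y 1, I η = (∫ η in Ioc y 1, m η / η) + ∫ η in Ioc y 1, (η * I η - m η) / η := by
    rw [← integral_add hm_int hrem_y1]
    refine setIntegral_congr_fun measurableSet_Ioc fun η hη ↦ ?_
    have hη0 : (0 : ℝ) < η := hy0.trans hη.1
    field_simp
    ring
  -- the polynomial part
  have hpoly : ∫ η in Ioc y 1, m η / η = ∑ i ∈ Finset.range (a + 1), ∑ j ∈ Finset.range (b + 1),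
      (a.choose i : ℝ) * (b.choose j : ℝ) * ((-1) ^ j + (-1) ^ i) * μ (i + j) *
        ((-1 / 2 : ℝ) ^ (a - i + (b - j)) * Real.log (1 / y) ^ (a - i + (b - j) + 1) / (((a - i + (b - j) : ℕ) : ℝ) + 1)) := by
    have hptw : ∀ η ∈ Ioc y 1, m η / η = ∑ i ∈ Finset.range (a + 1), ∑ j ∈ Finset.range (b + 1),
        ((a.choose i : ℝ) * (b.choose j : ℝ) * ((-1) ^ j + (-1) ^ i) * μ (i + j) * (-1 / 2 : ℝ) ^ (a - i + (b - j))) *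
          (Real.log (1 / η) ^ (a - i + (b - j)) / η) := by
      intro η hη
      simp only [hm, hμ]
      rw [shell_model_expand, Finset.sum_div]
      refine Finset.sum_congr rfl fun i _ ↦ ?_
      rw [Finset.sum_div]
      refine Finset.sum_congr rfl fun j _ ↦ ?_
      rw [show -(Real.log (1 / η) / 2) = (-1 / 2 : ℝ) * Real.log (1 / η) by ring, mul_pow, mul_pow, pow_add,
        pow_add]
      ring
    have hterm_int : ∀ p : ℕ, IntegrableOn (fun η : ℝ ↦ Real.log (1 / η) ^ p / η) (Ioc y 1) := by
      intro p
      refine (ContinuousOn.integrableOn_Icc ?_).mono_set Ioc_subset_Icc_self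
      refine ContinuousOn.div ?_ continuousOn_id fun η hη ↦ ne_of_gt (hy0.trans_le hη.1)
      refine ContinuousOn.pow (continuousOn_log.comp ?_ ?_) p
      · exact continuousOn_const.div continuousOn_id fun η hη ↦ ne_of_gt (hy0.trans_le hη.1)
      · intro η hη
        simp only [Set.mem_compl_iff, Set.mem_singleton_iff]
        exact one_div_ne_zero (ne_of_gt (hy0.trans_le hη.1))
    rw [setIntegral_congr_fun measurableSet_Ioc hptw,
      integral_finsetSum _ fun i _ ↦ integrable_finsetSum _ fun j _ ↦ (hterm_int _).const_mul _]
    refine Finset.sum_congr rfl fun i _ ↦ ?_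
    rw [integral_finsetSum _ fun j _ ↦ (hterm_int _).const_mul _]
    refine Finset.sum_congr rfl fun j _ ↦ ?_
    rw [integral_const_mul, integral_log_inv_pow_div _ hy0 hy1, div_one, Real.log_one, zero_pow (Nat.succ_ne_zero _),
      sub_zero]
    push_cast
    ring
  -- the remainder part: `∫_y^1 = ∫_0^1 − ∫_0^y`
  have hremsplit : ∫ η in Ioc y 1, (η * I η - m η) / η =
      (∫ η in Ioc 0 1, (η * I η - m η) / η) - ∫ η in Ioc 0 y, (η * I η - m η) / η := by
    rw [← Ioc_union_Ioc_eq_Ioc hy0.le hy1, setIntegral_union ?_ measurableSet_Ioc hrem_0y hrem_y1]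
    · ring
    · rw [Set.disjoint_left]; intro η h1 h2; exact absurd h2.1 (not_lt.2 h1.2)
  -- assemble
  have hmain : (∫ u₁ in Ioi (0 : ℝ), Real.log u₁ ^ a *
        ∫ u₂ in Ioi (y / u₁), Real.exp (-(u₁ + u₂)) / (1 - Real.exp (-(u₁ + u₂))) ^ 2 * Real.log u₂ ^ b) -
      ((∫ u₁ in Ioi (0 : ℝ), Real.log u₁ ^ a *
          ∫ u₂ in Ioi (1 / u₁), Real.exp (-(u₁ + u₂)) / (1 - Real.exp (-(u₁ + u₂))) ^ 2 * Real.log u₂ ^ b) +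
        (∫ η in Ioc (0 : ℝ) 1, (η * I η - m η) / η) +
        ∑ i ∈ Finset.range (a + 1), ∑ j ∈ Finset.range (b + 1),
          (a.choose i : ℝ) * (b.choose j : ℝ) * ((-1) ^ j + (-1) ^ i) * μ (i + j) *
            ((-1 / 2 : ℝ) ^ (a - i + (b - j)) * Real.log (1 / y) ^ (a - i + (b - j) + 1) / (((a - i + (b - j) : ℕ) : ℝ) + 1))) =
      -∫ η in Ioc 0 y, (η * I η - m η) / η := by
    rw [← hpoly]
    have h := hshell
    simp only [hI] at hsplit hremsplit ⊢
    linarith [hsplit, hremsplit, h]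
  have hgoal := hC y hy0 hy1
  simp only [hI, hm, hμ] at hmain ⊢
  rw [hmain, abs_neg]
  exact hgoal

end Summit.Parity.GeneralizedHardyLittlewood.Theorems.MomentsBeyondDiagonal.DiagLines

end
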